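import Literature.MathematicalPhysics.KineticTheory.InfiniteChainGibbsExistence
import Literature.MathematicalPhysics.KineticTheory.InfiniteChainMarkovShift
import HarnessLib

/-!
# A shift-invariant superstable Gibbs state of the anharmonic chain — PROVED

Topic `Literature/MathematicalPhysics/KineticTheory`; theorems only (no definitions, no named
facts). Sequel of `InfiniteChainGibbsExistence.lean` (existence of a superstable DLR Gibbs state
of the chain by the transfer-operator / Markov-chain construction) and
`InfiniteChainMarkovShift.lean` (measures with transfer-kernel window densities are shift
invariant). The construction of `InfiniteChainGibbsExistence` is re-run here in FACTORED form —
`exists_transferMarkovState` exposes the transfer data `(k, φ, w, L, D)` and the window formula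
`∫ Φ dμ = (∫⋯∫⁻ Φ · D a n)(η)` of the state — so that every structural property proved from the
window formula (DLR: `isChainGibbsMeasure_of_windowDensity`; superstability:
`hasSuperstabilityEstimate_of_windowDensity`; translation invariance:
`isShiftInvariant_of_windowDensity`) applies to ONE AND THE SAME state.

* `exists_transferMarkovState` — the two-sided stationary Markov chain of the transfer operator
  of the chain at `T > 0`, with its window formula;
* `exists_isChainGibbsMeasure_shiftInvariant_superstable` — **a DLR Gibbs state which is shift
  invariant and obeys BM (2.3)** (`U, V ≥ 0` continuous, `V` even, `e^{-U/T}, e^{-U/(2T)} ∈ L¹`);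
* `exists_isChainGibbsMeasure_shiftInvariant_superstable_pinnedChain` — the pinned anharmonic
  chain (`ω₂ > 0`, `lam, β ≥ 0`) at every `T > 0`: the regular thermal states asked for by the
  Fourier's-law routes (e.g. `stub_gibbsFamily` of the `GreenKuboContinuation` lines,
  `WindowDecomposition`, `CurrentTiltQuench.SymmetricSetup`).

[cite: Georgii2011, Thm 10.25 and §11.1] [cite: ButtaMarchioro2016, §2 eq. (2.3)]
-/

noncomputable section

open MeasureTheory Set Function Finset Filter Literature.Probability.LatticeModels
  Literature.Analysis.OperatorTheory
open scoped ENNReal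

namespace Literature.MathematicalPhysics.KineticTheory.HeatConduction

namespace OscillatorChain

variable (P : OscillatorChain)

/-- **The transfer-operator Markov state of the chain, with its window formula.** For `T > 0`,
`U`, `V` continuous, `V ≥ 0` even and `e^{-U/T} ∈ L¹` there are: measurable transfer data
`w = e^{-(p²/2+U)/T}`, `k(z,z') = e^{-V(q'-q)/T}`, a bounded eigenfunction `φ ≤ B`, an eigenvalue
`0 < L < ∞`, the window densities `D a n = φ(σ_a) φ(σ_{a+n}) ∏ (k L⁻¹) ∏ w`, and a probability
measure `μ` on `ℤ → ℝ × ℝ` with `∫ Φ dμ = (∫⋯∫⁻_{a,…,a+n} Φ · D a n)(η)` for every measurable `Φ ≥ 0`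
depending on the window `{a, …, a+n}` (Jentzsch + Kolmogorov; the law of the two-sided stationary
Markov chain of Cassandro–Olivieri–Pellegrinotti–Presutti 1978, §2).
[cite: Georgii2011, Thm 10.25 and §11.1] -/
theorem exists_transferMarkovState {T : ℝ} (hT : 0 < T)
    (hUc : Continuous P.U) (hVc : Continuous P.V) (hV0 : ∀ r, 0 ≤ P.V r)
    (hVe : ∀ r, P.V (-r) = P.V r)
    (hUi : Integrable (fun q : ℝ => Real.exp (-T⁻¹ * P.U q))) :
    ∃ (k : ℝ × ℝ → ℝ × ℝ → ℝ≥0∞) (φ w : ℝ × ℝ → ℝ≥0∞) (L : ℝ≥0∞) (B : ℝ)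
      (D : ℤ → ℕ → ChainConfig → ℝ≥0∞) (μ : Measure ChainConfig),
      Measurable (uncurry k) ∧ Measurable φ ∧ Measurable w ∧
      (∀ z, w z = ENNReal.ofReal (Real.exp (-T⁻¹ * (z.2 ^ 2 / 2 + P.U z.1)))) ∧
      (∀ z z', k z z' = ENNReal.ofReal (Real.exp (-T⁻¹ * P.V (z'.1 - z.1)))) ∧
      (∀ z, φ z ≤ ENNReal.ofReal B) ∧ L ≠ 0 ∧ L ≠ ∞ ∧
      (∀ a n σ, D a n σ = φ (σ a) * φ (σ (a + n)) *
        (∏ j ∈ Finset.range n, k (σ (a + j)) (σ (a + j + 1)) * L⁻¹) *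
        ∏ j ∈ Finset.range (n + 1), w (σ (a + j))) ∧
      IsProbabilityMeasure μ ∧
      ∀ (a : ℤ) (n : ℕ) (Φ : ChainConfig → ℝ≥0∞), Measurable Φ →
        DependsOn Φ (↑(Finset.Icc a (a + n)) : Set ℤ) → ∀ η : ChainConfig,
          ∫⁻ σ, Φ σ ∂μ = (∫⋯∫⁻_Finset.Icc a (a + n), (fun σ => Φ σ * D a n σ)
            ∂fun _ : ℤ => (volume : Measure (ℝ × ℝ))) η := by
  classical
  have hUm : Measurable P.U := hUc.measurable
  have hVm : Measurable P.V := hVc.measurable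
  -- Step 1: the a priori measure `ρ_T` and the transfer kernel `K`
  obtain ⟨wt, hwt⟩ : ∃ wt : ℝ × ℝ → ℝ, ∀ z, wt z = Real.exp (-T⁻¹ * (z.2 ^ 2 / 2 + P.U z.1)) :=
    ⟨_, fun _ => rfl⟩
  have hwt_eq : wt = fun z => Real.exp (-T⁻¹ * (z.2 ^ 2 / 2 + P.U z.1)) := funext hwt
  have hwtc : Continuous wt := by rw [hwt_eq]; fun_prop
  have hwti : Integrable wt := by rw [hwt_eq]; exact P.integrable_siteWeight hT hUi
  have hwtpos : ∀ z, 0 < wt z := fun z => by rw [hwt]; exact Real.exp_pos _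
  set ρ : Measure (ℝ × ℝ) := volume.withDensity fun z => ENNReal.ofReal (wt z) with hρ
  haveI : IsFiniteMeasure ρ := isFiniteMeasure_withDensity_ofReal hwti.2
  have hwtm : Measurable fun z => ENNReal.ofReal (wt z) := ENNReal.measurable_ofReal.comp hwtc.measurable
  have hρ0 : ρ ≠ 0 := by
    intro h0
    have h1 : ρ univ = 0 := by rw [h0]; rfl
    rw [hρ, withDensity_apply _ MeasurableSet.univ, Measure.restrict_univ,
      lintegral_eq_zero_iff hwtm] at h1
    have h2 : (volume : Measure (ℝ × ℝ)) {z | (fun z => ENNReal.ofReal (wt z)) z ≠ (0 : ℝ × ℝ → ℝ≥0∞) z} = 0 :=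
      h1
    have h3 : {z : ℝ × ℝ | (fun z => ENNReal.ofReal (wt z)) z ≠ (0 : ℝ × ℝ → ℝ≥0∞) z} = univ :=
      eq_univ_of_forall fun z => (ENNReal.ofReal_pos.2 (hwtpos z)).ne'
    rw [h3] at h2
    exact (isOpen_univ.measure_pos (volume : Measure (ℝ × ℝ)) univ_nonempty).ne' h2
  obtain ⟨K, hK⟩ : ∃ K : ℝ × ℝ → ℝ × ℝ → ℝ, ∀ z z', K z z' = Real.exp (-T⁻¹ * P.V (z'.1 - z.1)) :=
    ⟨_, fun _ _ => rfl⟩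
  have hKc : Continuous (uncurry K) := by
    rw [show uncurry K = fun p : (ℝ × ℝ) × (ℝ × ℝ) => Real.exp (-T⁻¹ * P.V (p.2.1 - p.1.1)) from
      funext fun p => hK p.1 p.2]
    fun_prop
  have hKsm : StronglyMeasurable (uncurry K) := hKc.stronglyMeasurable
  have hKpos : ∀ z z', 0 < K z z' := fun z z' => by rw [hK]; exact Real.exp_pos _
  have hK1 : ∀ z z', ‖K z z'‖ ≤ 1 := fun z z' => by
    rw [Real.norm_eq_abs, abs_of_pos (hKpos z z'), hK, Real.exp_le_one_iff]
    have := hV0 (z'.1 - z.1)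
    have := inv_pos.2 hT
    nlinarith
  have hKsymm : ∀ z z', K z z' = K z' z := fun z z' => by
    rw [hK, hK, ← hVe (z.1 - z'.1), neg_sub]
  -- Step 2: Jentzsch's pointwise eigenfunction
  obtain ⟨lam, h, B, hlam, hhm, hhpos, hhle, heig', hnorm'⟩ :=
    exists_pointwise_eigenfunction_lintegral (μ := ρ) hKsm hK1 hKsymm hKpos hρ0
  -- the `ℝ≥0∞` transfer data on Lebesgue measure
  obtain ⟨φ, hφ⟩ : ∃ φ : ℝ × ℝ → ℝ≥0∞, ∀ z, φ z = ENNReal.ofReal (h z) := ⟨_, fun _ => rfl⟩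
  obtain ⟨w, hw⟩ : ∃ w : ℝ × ℝ → ℝ≥0∞, ∀ z, w z = ENNReal.ofReal (wt z) := ⟨_, fun _ => rfl⟩
  obtain ⟨k, hk⟩ : ∃ k : ℝ × ℝ → ℝ × ℝ → ℝ≥0∞, ∀ z z', k z z' = ENNReal.ofReal (K z z') :=
    ⟨_, fun _ _ => rfl⟩
  set L : ℝ≥0∞ := ENNReal.ofReal lam with hL
  have hL0 : L ≠ 0 := (ENNReal.ofReal_pos.2 hlam).ne'
  have hLt : L ≠ ∞ := ENNReal.ofReal_ne_top
  have hφm : Measurable φ := by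
    rw [show φ = fun z => ENNReal.ofReal (h z) from funext hφ]
    exact ENNReal.measurable_ofReal.comp hhm
  have hwm : Measurable w := by
    rw [show w = fun z => ENNReal.ofReal (wt z) from funext hw]; exact hwtm
  have hkm : Measurable (uncurry k) := by
    rw [show uncurry k = fun p => ENNReal.ofReal (uncurry K p) from funext fun p => hk p.1 p.2]
    exact ENNReal.measurable_ofReal.comp hKc.measurable
  have hsym : ∀ z y, k z y = k y z := fun z y => by rw [hk, hk, hKsymm]
  have hφB : ∀ z, φ z ≤ ENNReal.ofReal B := fun z => by rw [hφ]; exact ENNReal.ofReal_le_ofReal (hhle z)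
  have hw' : ∀ z, w z = ENNReal.ofReal (Real.exp (-T⁻¹ * (z.2 ^ 2 / 2 + P.U z.1))) := fun z => by
    rw [hw, hwt]
  have hk' : ∀ z z', k z z' = ENNReal.ofReal (Real.exp (-T⁻¹ * P.V (z'.1 - z.1))) := fun z z' => by
    rw [hk, hK]
  -- the eigen-equation and the normalisation on Lebesgue measure
  have heig : ∀ z, ∫⁻ y, k z y * φ y * w y ∂(volume : Measure (ℝ × ℝ)) = L * φ z := by
    intro z
    have hg : Measurable fun y => ENNReal.ofReal (K z y) * ENNReal.ofReal (h y) :=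
      (ENNReal.measurable_ofReal.comp (hKc.measurable.comp (measurable_const.prodMk measurable_id))).mul
        (ENNReal.measurable_ofReal.comp hhm)
    have h1 := heig' z
    rw [hρ, lintegral_withDensity_eq_lintegral_mul _ hwtm hg] at h1
    rw [hL, hφ, ← ENNReal.ofReal_mul hlam.le, ← h1]
    refine lintegral_congr fun y => ?_
    simp only [Pi.mul_apply, hk, hφ, hw]
    ring
  have hnorm : ∫⁻ y, φ y ^ 2 * w y ∂(volume : Measure (ℝ × ℝ)) = 1 := by
    have hg : Measurable fun y => ENNReal.ofReal (h y) ^ 2 := (ENNReal.measurable_ofReal.comp hhm).pow_const 2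
    have h1 := hnorm'
    rw [hρ, lintegral_withDensity_eq_lintegral_mul _ hwtm hg] at h1
    rw [← h1]
    refine lintegral_congr fun y => ?_
    simp only [Pi.mul_apply, hφ, hw]
    ring
  -- Step 3: the two-sided stationary Markov chain
  obtain ⟨D, hD⟩ : ∃ D : ℤ → ℕ → ChainConfig → ℝ≥0∞, ∀ a n σ, D a n σ = φ (σ a) * φ (σ (a + n)) *
      (∏ j ∈ Finset.range n, k (σ (a + j)) (σ (a + j + 1)) * L⁻¹) *
      ∏ j ∈ Finset.range (n + 1), w (σ (a + j)) := ⟨_, fun _ _ _ => rfl⟩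
  obtain ⟨μ, hμprob, hμ⟩ := exists_markovChainMeasure (S := ℝ × ℝ) (ν := (volume : Measure (ℝ × ℝ)))
    hkm hφm hwm hL0 hLt heig hsym hnorm hD
  haveI := hμprob
  exact ⟨k, φ, w, L, B, D, μ, hkm, hφm, hwm, hw', hk', hφB, hL0, hLt, hD, hμprob, hμ⟩

/-- **A shift-invariant superstable DLR Gibbs state of the chain.** Let `T > 0`, `U`, `V`
continuous and non-negative, `V` even, `e^{-U/T}`, `e^{-U/(2T)}` Lebesgue integrable. Then there is a
probability measure `μ` on `ℤ → ℝ × ℝ` which is a Gibbs state of `P` at `T` (DLR for every finite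
volume), is invariant under the spatial shift, and satisfies Buttà–Marchioro's superstability
estimate (2.3) — the transfer-operator Markov state. [cite: Georgii2011, Thm 10.25 and §11.1] -/
theorem exists_isChainGibbsMeasure_shiftInvariant_superstable {T : ℝ} (hT : 0 < T)
    (hUc : Continuous P.U) (hVc : Continuous P.V) (hU0 : ∀ r, 0 ≤ P.U r) (hV0 : ∀ r, 0 ≤ P.V r)
    (hVe : ∀ r, P.V (-r) = P.V r)
    (hUi : Integrable (fun q : ℝ => Real.exp (-T⁻¹ * P.U q)))
    (hUi2 : Integrable (fun q : ℝ => Real.exp (-(2 * T)⁻¹ * P.U q))) :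
    ∃ μ : Measure ChainConfig, P.IsChainGibbsMeasure T μ ∧ IsShiftInvariant μ ∧
      P.HasSuperstabilityEstimate μ := by
  have hUm : Measurable P.U := hUc.measurable
  have hVm : Measurable P.V := hVc.measurable
  obtain ⟨k, φ, w, L, B, D, μ, hkm, hφm, hwm, hw', hk', hφB, hL0, -, hD, hμprob, hμ⟩ :=
    P.exists_transferMarkovState hT hUc hVc hV0 hVe hUi
  haveI := hμprob
  have hfac : ∀ (Λ : Finset ℤ) (σ : ChainConfig),
      ENNReal.ofReal (Real.exp (-T⁻¹ * hamiltonianIn P.chainPotential chainSupp Λ σ)) =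
        (∏ x ∈ Λ, w (σ x)) * ∏ y ∈ bondSet Λ, k (σ y) (σ (y + 1)) := fun Λ σ => by
    rw [P.ofReal_exp_neg_hamiltonianIn T Λ σ]
    simp only [hw', hk']
  have hZ : ∀ (Λ : Finset ℤ) (η : ChainConfig), (∫⋯∫⁻_Λ, (fun σ =>
      ENNReal.ofReal (Real.exp (-T⁻¹ * hamiltonianIn P.chainPotential chainSupp Λ σ)))
      ∂fun _ : ℤ => (volume : Measure (ℝ × ℝ))) η ≠ ∞ := fun Λ η =>
    (P.lmarginal_boltzmann_lt_top hT hV0 hUi Λ η).ne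
  exact ⟨μ, P.isChainGibbsMeasure_of_windowDensity hUm hVm hkm hφm hwm hD hfac hZ hμ,
    isShiftInvariant_of_windowDensity hkm hφm hwm hD hμ,
    P.hasSuperstabilityEstimate_of_windowDensity hUm hVm hT hU0 hV0 hVe hUi2 hw' hk' hφB hL0 hD hμ⟩

/-- **The pinned anharmonic chain has a shift-invariant superstable Gibbs state at every
temperature.** For `pinnedChain ω₂ lam β γ` (`ω₂ > 0`, `lam, β ≥ 0`) and `T > 0` there is a DLR
Gibbs state which is translation invariant and obeys BM (2.3) — a "regular thermal state" in the
sense of the Fourier's-law routes. [cite: Georgii2011, Thm 10.25 and §11.1] -/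
theorem exists_isChainGibbsMeasure_shiftInvariant_superstable_pinnedChain {ω₂ lam β : ℝ} (γ : ℝ)
    (hω : 0 < ω₂) (hl : 0 ≤ lam) (hβ : 0 ≤ β) {T : ℝ} (hT : 0 < T) :
    ∃ μ : Measure ChainConfig, (pinnedChain ω₂ lam β γ).IsChainGibbsMeasure T μ ∧
      IsShiftInvariant μ ∧ (pinnedChain ω₂ lam β γ).HasSuperstabilityEstimate μ := by
  refine (pinnedChain ω₂ lam β γ).exists_isChainGibbsMeasure_shiftInvariant_superstable hT
    ?_ ?_ ?_ ?_ ?_ (integrable_exp_neg_pinning hT hω hl β γ) ?_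
  · show Continuous fun q : ℝ => ω₂ * q ^ 2 / 2 + lam * q ^ 4 / 4
    fun_prop
  · show Continuous fun r : ℝ => r ^ 2 / 2 + β * r ^ 4 / 4
    fun_prop
  · intro q
    show 0 ≤ ω₂ * q ^ 2 / 2 + lam * q ^ 4 / 4
    positivity
  · intro r
    show 0 ≤ r ^ 2 / 2 + β * r ^ 4 / 4
    positivity
  · intro r
    show (-r) ^ 2 / 2 + β * (-r) ^ 4 / 4 = r ^ 2 / 2 + β * r ^ 4 / 4
    ring
  · have h2T : 0 < 2 * T := by positivity
    exact integrable_exp_neg_pinning h2T hω hl β γ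

/-- The family form: a map `T ↦ μ_T` of shift-invariant superstable Gibbs states of the pinned chain
(choice over `exists_isChainGibbsMeasure_shiftInvariant_superstable_pinnedChain`; arbitrary for
`T ≤ 0`). [cite: Georgii2011, Thm 10.25 and §11.1] -/
theorem exists_gibbsFamily_pinnedChain {ω₂ lam β : ℝ} (γ : ℝ) (hω : 0 < ω₂) (hl : 0 ≤ lam)
    (hβ : 0 ≤ β) :
    ∃ μ : ℝ → Measure ChainConfig, ∀ T : ℝ, 0 < T →
      (pinnedChain ω₂ lam β γ).IsChainGibbsMeasure T (μ T) ∧ IsShiftInvariant (μ T) ∧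
        (pinnedChain ω₂ lam β γ).HasSuperstabilityEstimate (μ T) := by
  classical
  refine ⟨fun T => if hT : 0 < T then
      (exists_isChainGibbsMeasure_shiftInvariant_superstable_pinnedChain γ hω hl hβ hT).choose
    else 0, fun T hT => ?_⟩
  simp only [dif_pos hT]
  exact (exists_isChainGibbsMeasure_shiftInvariant_superstable_pinnedChain γ hω hl hβ hT).choose_spec

end OscillatorChain

end Literature.MathematicalPhysics.KineticTheory.HeatConduction

end
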